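import Summits.FinalStateConjecture.FinalStateConjecture.Theorems.EIHFluxBalanceInertialRecessionStubSlavingHelpers
import Literature.Geometry.Lorentzian.BackgroundChartCalculus
import Literature.Geometry.Lorentzian.BoundedGeometry
import Literature.Geometry.Lorentzian.KerrSchildChartCovariance
import Literature.Geometry.Lorentzian.MetricLocality
import Literature.Geometry.Lorentzian.CoordScalarJet
import HarnessLib

/-!
# Crux `ClusterCompleteness.OmegaLimitMultiKerr` (stmt-FinalStateConjecture-14664), line `Sketch` —
# chart metrics of late charts of a VACUUM development are coordinate-Ricci-flat at immersion points

Support lemmas (structure stub `ricAt_chartMetricExtend_eq_zero`, lead gen 3) for the crux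
`OmegaLimitMultiKerr`. Step one of the identification of the ω-LIMITS of the translated chart
metrics of the tame hole / flat charts of a vacuum MGHD is "the limits are vacuum": coordinate
Ricci-flatness `ricAt = 0` passes to `supCkENorm`-`C²` limits GIVEN that every translate is
coordinate-Ricci-flat, and this file supplies exactly that input from
`VacuumCauchyDevelopment.isRicciFlat`, over the tree's chart vocabulary
(`Spacetime.chartMetric / chartMetricExtend` of `BoundedGeometry.lean`, the coordinate Ricci form
`MetricCoord.ricAt` of `CoordCurvature.lean`):

* `chartMetric_nondegenerate_of_injective`, `isInvertible_chartMetric_of_injective`,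
  `injective_mfderiv_of_isInvertible_chartMetric` — at a point `x` of the chart domain, `dΨ_x` is
  injective iff the chart metric `(Ψ^* g)(x)` is nondegenerate (equidimension `4 = 4`; O'Neill 1983,
  Ch. 3, p. 90);
* `exists_opens_injective_mfderiv` — **the immersion locus of a smooth chart map is open**: the
  components `Ψ^* g` are continuous on the open domain and the invertible forms are open;
* `isMetricOn_chartMetricExtend` — on an open set of immersion points the (zero-extended) chart
  metric components are METRIC COMPONENTS in the sense of the coordinate calculus
  (`MetricCoord.IsMetricOn`: smooth, symmetric, invertible), so that `CoordCurvature.lean` ff. apply;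
* `ricAt_chartMetricExtend_eq_zero_of_isRicciFlat` — for a Ricci-flat spacetime, `ricAt (Ψ^* g) = 0`
  on every open set of immersion points: the Ricci bridge
  `SublinearIsFree.Slaving.ricAt_deviationExtend_add_bilin_eq_zero` (naturality of `Ric` under the
  local isometry `(A, Ψ^* g) → (𝓢, g)`, `ricci_comap_apply`, O'Neill 1983, Ch. 3, Prop. 3.59, and
  `OpensChart.ricci_eq_ricAt`, Lemma 3.52) read for the representative `chartMetricExtend B Ψ`,
  which has the same germ as `(Ψ^* g − g₀) + g₀` at points of the domain (`ricAt` only sees the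
  `2`-jet, `MetricCoord.ricAt_congr_metric`);
* `ricAt_chartMetricExtend_eq_zero` (MAIN, registered closed form) — for a VACUUM Cauchy development
  `𝒟` and a smooth chart map `Ψ : B.domain → 𝒟` on a model background `B`,
  `ricAt (chartMetricExtend B Ψ) x = 0` at every point `x` where `dΨ_x` is injective (pointwise
  hypothesis; openness of the immersion locus supplies the neighbourhood);
  `ricAt_chartMetricExtend_eq_zero_of_isLocalDiffeomorphAt` is the form fed by the anchor
  (`isLocalDiffeomorphAt_of_anchor`, file `…OmegaLimitMultiKerrAnchor`), and
  `ricAt_chartMetricExtend_translate_eq_zero` the form for the time-TRANSLATES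
  `y ↦ (Ψ^* g)(y + e)` (`MetricCoord.ricAt_comp_add_right`).

Everything is proved; Mathlib + `Literature` + landed `Theorems` files only, no definitions.
-/

-- every `Summit.FinalStateConjecture.FinalStateConjecture.…` name repeats the summit = sub-problem segment (D-0017 layout)
set_option linter.dupNamespace false
-- the normed-group instances on `E4 →L[ℝ] E4 →L[ℝ] ℝ` need one more level of pending instance
-- problems than the default (as in `CoordCurvature.lean`)
set_option maxSynthPendingDepth 3

noncomputable section

open scoped Manifold ContDiff Topology ENNReal
open Set Filter TopologicalSpace

namespace Summit.FinalStateConjecture.FinalStateConjecture.Theorems.ClusterCompleteness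

open Literature.Geometry.Lorentzian

/-! ### Immersion points = points where the chart metric is nondegenerate -/

/-- **At an immersion point the chart metric is nondegenerate**: if `dΨ_x` is injective — hence onto,
`dim E4 = dim T_{Ψ x}𝓢 = 4` (`mfderiv_bijective_of_injective`) — and `(Ψ^* g)(x)(v, ·) = 0`, then
`g(dΨ_x v, ·)` vanishes on all of `T_{Ψ x}𝓢`, so `dΨ_x v = 0` and `v = 0`.
[cite: ONeill1983, Ch. 3, p. 90] -/
theorem chartMetric_nondegenerate_of_injective (𝓢 : Spacetime 4) (B : ModelBackground)
    (Ψ : B.domain → 𝓢.carrier) {x : B.domain}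
    (hx : Function.Injective (mfderiv 𝓘(ℝ, E4) (𝓡 4) Ψ x)) (v : E4)
    (hv : ∀ w : E4, 𝓢.chartMetric B Ψ x v w = 0) : v = 0 := by
  have hdim : Module.finrank ℝ E4 = Module.finrank ℝ (EuclideanSpace ℝ (Fin 4)) := rfl
  have hsurj := (mfderiv_bijective_of_injective hx hdim).2
  have h0 : mfderiv 𝓘(ℝ, E4) (𝓡 4) Ψ x v = 0 := by
    refine 𝓢.metric.nondegenerate (Ψ x) _ fun u ↦ ?_
    obtain ⟨w, rfl⟩ := hsurj u
    have h := hv w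
    rwa [Spacetime.chartMetric_apply] at h
  exact hx (h0.trans (map_zero _).symm)

/-- Hence `(Ψ^* g)(x)` is invertible (as a map `E4 → E4*`) at immersion points.
[cite: ONeill1983, Ch. 3, p. 90] -/
theorem isInvertible_chartMetric_of_injective (𝓢 : Spacetime 4) (B : ModelBackground)
    (Ψ : B.domain → 𝓢.carrier) {x : B.domain}
    (hx : Function.Injective (mfderiv 𝓘(ℝ, E4) (𝓡 4) Ψ x)) :
    (𝓢.chartMetric B Ψ x).IsInvertible :=
  MetricCoord.isInvertible_of_nondegenerate (chartMetric_nondegenerate_of_injective 𝓢 B Ψ hx)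

/-- Conversely, where `(Ψ^* g)(x)` is invertible the differential `dΨ_x` is injective (a kernel
vector of `dΨ_x` pairs to zero with everything). [cite: ONeill1983, Ch. 3, p. 90] -/
theorem injective_mfderiv_of_isInvertible_chartMetric (𝓢 : Spacetime 4) (B : ModelBackground)
    (Ψ : B.domain → 𝓢.carrier) {x : B.domain} (hx : (𝓢.chartMetric B Ψ x).IsInvertible) :
    Function.Injective (mfderiv 𝓘(ℝ, E4) (𝓡 4) Ψ x) := by
  obtain ⟨e, he⟩ := hx
  refine (injective_iff_map_eq_zero _).2 fun v hv ↦ ?_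
  have h0 : 𝓢.chartMetric B Ψ x v = 0 := by
    ext w
    rw [Spacetime.chartMetric_apply, hv, map_zero, zero_apply, zero_apply]
  have h1 : e v = 0 := by rw [← ContinuousLinearEquiv.coe_coe, he, h0]
  exact e.map_eq_zero_iff.1 h1

/-! ### The immersion locus is open -/

/-- **The immersion locus of a smooth chart map is open**: if `dΨ_x` is injective there is an open
set `A ∋ x` of `E4` inside the chart domain on which `dΨ` is injective — the components `(Ψ^* g)(y)`
are continuous in `y` on the open domain (they are even `C^∞`,
`KerrSchildChart.contDiffAt_chartMetric`), invertible at `x`, and the invertible forms form an open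
set (`ContinuousLinearEquiv.isOpen`). [cite: ONeill1983, Ch. 3, p. 90] -/
theorem exists_opens_injective_mfderiv (𝓢 : Spacetime 4) (B : ModelBackground)
    {Ψ : B.domain → 𝓢.carrier} (hΨ : ContMDiff 𝓘(ℝ, E4) (𝓡 4) ∞ Ψ) (x : B.domain)
    (hx : Function.Injective (mfderiv 𝓘(ℝ, E4) (𝓡 4) Ψ x)) :
    ∃ (A : Opens E4) (hA : A ≤ B.domain), (x : E4) ∈ A ∧
      ∀ y : A, Function.Injective (mfderiv 𝓘(ℝ, E4) (𝓡 4) Ψ (Opens.inclusion hA y)) := by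
  have hcont : ContinuousOn (𝓢.chartMetricExtend B Ψ) (B.domain : Set E4) := fun y hy ↦
    (KerrSchildChart.contDiffAt_chartMetric hΨ (Gp := 𝓢.chartMetricExtend B Ψ)
      (fun z ↦ (𝓢.chartMetricExtend_coe B Ψ z).symm) ⟨y, hy⟩).continuousAt.continuousWithinAt
  have hopen : IsOpen {T : E4 →L[ℝ] E4 →L[ℝ] ℝ | T.IsInvertible} := by
    have h : {T : E4 →L[ℝ] E4 →L[ℝ] ℝ | T.IsInvertible} =
        range ((↑) : (E4 ≃L[ℝ] (E4 →L[ℝ] ℝ)) → E4 →L[ℝ] E4 →L[ℝ] ℝ) := by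
      ext T
      exact ⟨fun ⟨e, he⟩ ↦ ⟨e, he⟩, fun ⟨e, he⟩ ↦ ⟨e, he⟩⟩
    rw [h]
    exact ContinuousLinearEquiv.isOpen
  have hO : IsOpen ((B.domain : Set E4) ∩ 𝓢.chartMetricExtend B Ψ ⁻¹' {T | T.IsInvertible}) :=
    hcont.isOpen_inter_preimage B.domain.2 hopen
  refine ⟨⟨_, hO⟩, fun _ hy ↦ hy.1, ⟨x.2, ?_⟩, fun y ↦ ?_⟩
  · show (𝓢.chartMetricExtend B Ψ x).IsInvertible
    rw [Spacetime.chartMetricExtend_coe]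
    exact isInvertible_chartMetric_of_injective 𝓢 B Ψ hx
  · have hy : (𝓢.chartMetricExtend B Ψ
        ((Opens.inclusion (fun _ hy ↦ hy.1 : (⟨_, hO⟩ : Opens E4) ≤ B.domain) y : B.domain) : E4)).IsInvertible :=
      y.2.2
    rw [Spacetime.chartMetricExtend_coe] at hy
    exact injective_mfderiv_of_isInvertible_chartMetric 𝓢 B Ψ hy

/-! ### Metric components and the Ricci bridge on an open set of immersion points -/

/-- **On an open set `A` of immersion points the chart metric components are metric components**
(`MetricCoord.IsMetricOn`: `C^∞` on `A` — `KerrSchildChart.contDiffAt_chartMetric`, from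
`contMDiff_pullbackBilin_holds`, O'Neill 1983, Ch. 3, Lemma 3.35 —, symmetric, and invertible at every
point of `A` by `isInvertible_chartMetric_of_injective`), so that the whole coordinate tensor
calculus `CoordCurvature.lean` ff. applies to `chartMetricExtend B Ψ` on `A`.
[cite: ONeill1983, Ch. 3, Def. 3.1 and p. 90] -/
theorem isMetricOn_chartMetricExtend (𝓢 : Spacetime 4) (B : ModelBackground)
    {Ψ : B.domain → 𝓢.carrier} (hΨ : ContMDiff 𝓘(ℝ, E4) (𝓡 4) ∞ Ψ) {A : Opens E4}
    (hA : A ≤ B.domain)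
    (hinj : ∀ y : A, Function.Injective (mfderiv 𝓘(ℝ, E4) (𝓡 4) Ψ (Opens.inclusion hA y))) :
    MetricCoord.IsMetricOn (𝓢.chartMetricExtend B Ψ) (A : Set E4) :=
  KerrSchildChart.isMetricOn_chartMetric hΨ (Gp := 𝓢.chartMetricExtend B Ψ)
    (fun z ↦ (𝓢.chartMetricExtend_coe B Ψ z).symm) A.2 (fun _ hz ↦ hA hz) fun y hy ↦ by
      have h := isInvertible_chartMetric_of_injective 𝓢 B Ψ (hinj ⟨y, hy⟩)
      rwa [← Spacetime.chartMetricExtend_coe] at h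

/-- **The Ricci bridge for the chart metric.** For a Ricci-flat spacetime (hypothesis in the shape of
the field `VacuumCauchyDevelopment.isRicciFlat`), a smooth chart map `Ψ : B.domain → 𝓢` and an open
set `A ⊆ B.domain` on which `dΨ` is injective, the coordinate Ricci form of the chart metric
components vanishes on `A`: `ricAt (chartMetricExtend B Ψ) y = 0` for `y ∈ A`. This is
`SublinearIsFree.Slaving.ricAt_deviationExtend_add_bilin_eq_zero` (`(A, Ψ^* g)` is locally isometric
to `(𝓢, g)` along `Ψ`, so `Ric(Ψ^* g) = Ψ^* Ric(g) = 0`, `ricci_comap_apply`, and the Ricci tensor of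
a metric on an open subset of `E4` is `ricAt` of its components, `OpensChart.ricci_eq_ricAt`) for the
representative `chartMetricExtend B Ψ`, which agrees with `(Ψ^* g − g₀) + g₀` on the open domain
(`Spacetime.deviationExtend_coe_eq`) — and `ricAt` at a point only sees the germ
(`MetricCoord.ricAt_congr_metric`). [cite: ONeill1983, Ch. 3, Prop. 3.59 and Lemma 3.52] -/
theorem ricAt_chartMetricExtend_eq_zero_of_isRicciFlat (𝓢 : Spacetime 4)
    (hRic : ∀ [𝓢.metric.toPseudoRiemannianMetric.HasLeviCivita],
      𝓢.metric.toPseudoRiemannianMetric.IsRicciFlat)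
    (B : ModelBackground) {Ψ : B.domain → 𝓢.carrier} (hΨ : ContMDiff 𝓘(ℝ, E4) (𝓡 4) ∞ Ψ)
    {A : Opens E4} (hA : A ≤ B.domain)
    (hinj : ∀ y : A, Function.Injective (mfderiv 𝓘(ℝ, E4) (𝓡 4) Ψ (Opens.inclusion hA y)))
    (y : A) (v w : E4) :
    MetricCoord.ricAt (𝓢.chartMetricExtend B Ψ) y.1 v w = 0 := by
  have hgerm : 𝓢.chartMetricExtend B Ψ =ᶠ[𝓝 (y.1 : E4)]
      fun z ↦ 𝓢.deviationExtend B Ψ z + B.bilin z := by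
    filter_upwards [B.domain.2.mem_nhds (hA y.2)] with z hz
    have e : 𝓢.deviationExtend B Ψ z = 𝓢.chartMetricExtend B Ψ z - B.bilin z :=
      𝓢.deviationExtend_coe_eq B Ψ ⟨z, hz⟩
    rw [e]
    exact (sub_add_cancel _ _).symm
  rw [MetricCoord.ricAt_congr_metric hgerm]
  exact SublinearIsFree.Slaving.ricAt_deviationExtend_add_bilin_eq_zero 𝓢 hRic B hΨ hA hinj y v w

/-! ### The registered stub: vacuum developments -/

/-- **Chart metrics of late charts of a vacuum development are coordinate-Ricci-flat at immersion
points** (registered structure stub of line `Sketch`, crux stmt-FinalStateConjecture-14664; the input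
`hric` of the vacuum-limit lemma for ω-limits of hole/flat charts). For a VACUUM Cauchy development
`𝒟` (`VacuumCauchyDevelopment.isRicciFlat : Ric(g) = 0`), a model background `B` and a smooth chart
map `Ψ : B.domain → 𝒟`, at every point `x` of the domain where `dΨ_x` is injective the coordinate
Ricci form of the chart metric components `chartMetricExtend B Ψ = Ψ^* g` vanishes:
`ricAt (Ψ^* g) x = 0`. The pointwise immersion hypothesis suffices: the immersion locus is open
(`exists_opens_injective_mfderiv`), and on it the Ricci bridge
`ricAt_chartMetricExtend_eq_zero_of_isRicciFlat` applies (`Ric(Ψ^* g) = Ψ^* Ric(g) = 0`, O'Neill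
1983, Ch. 3, Prop. 3.59, read in coordinates, Lemma 3.52). Anchored charts are immersions at every
late point (`isLocalDiffeomorphAt_of_anchor`), so the hypothesis is met on every late certified
region. [cite: ONeill1983, Ch. 3, Prop. 3.59 and Lemma 3.52] -/
theorem ricAt_chartMetricExtend_eq_zero : ∀ {X : Type} [TopologicalSpace X] [ChartedSpace E3 X] [IsManifold (𝓡 3) ∞ X] [ConnectedSpace X] {D : InitialDataSet (𝓡 3) X} (𝒟 : VacuumCauchyDevelopment D) (B : ModelBackground) (Ψ : B.domain → 𝒟.carrier), ContMDiff 𝓘(ℝ, E4) (𝓡 4) ∞ Ψ → ∀ x : B.domain, Function.Injective (mfderiv 𝓘(ℝ, E4) (𝓡 4) Ψ x) → ∀ Y Z : E4, MetricCoord.ricAt (𝒟.toSpacetime.chartMetricExtend B Ψ) (x : E4) Y Z = 0 := by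
  intro X _ _ _ _ D 𝒟 B Ψ hΨ x hx Y Z
  obtain ⟨A, hA, hxA, hinj⟩ := exists_opens_injective_mfderiv 𝒟.toSpacetime B hΨ x hx
  exact ricAt_chartMetricExtend_eq_zero_of_isRicciFlat 𝒟.toSpacetime 𝒟.isRicciFlat B hΨ hA hinj
    ⟨x, hxA⟩ Y Z

/-- **Local-diffeomorphism form** (the shape delivered by the anchor, `isLocalDiffeomorphAt_of_anchor`
of file `…OmegaLimitMultiKerrAnchor`): if the smooth chart map `Ψ` of a vacuum development is a local
diffeomorphism at `x`, then `ricAt (Ψ^* g) x = 0` (its differential at `x` is a linear equivalence,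
`IsLocalDiffeomorphAt.mfderivToContinuousLinearEquiv`, in particular injective).
[cite: ONeill1983, Ch. 3, Prop. 3.59 and Lemma 3.52] -/
theorem ricAt_chartMetricExtend_eq_zero_of_isLocalDiffeomorphAt {X : Type} [TopologicalSpace X]
    [ChartedSpace E3 X] [IsManifold (𝓡 3) ∞ X] [ConnectedSpace X] {D : InitialDataSet (𝓡 3) X}
    (𝒟 : VacuumCauchyDevelopment D) (B : ModelBackground) {Ψ : B.domain → 𝒟.carrier}
    (hΨ : ContMDiff 𝓘(ℝ, E4) (𝓡 4) ∞ Ψ) {x : B.domain}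
    (hx : IsLocalDiffeomorphAt 𝓘(ℝ, E4) (𝓡 4) ∞ Ψ x) (Y Z : E4) :
    MetricCoord.ricAt (𝒟.toSpacetime.chartMetricExtend B Ψ) (x : E4) Y Z = 0 := by
  refine ricAt_chartMetricExtend_eq_zero 𝒟 B Ψ hΨ x ?_ Y Z
  have h := (hx.mfderivToContinuousLinearEquiv (by simp)).injective
  rwa [← ContinuousLinearEquiv.coe_coe, IsLocalDiffeomorphAt.mfderivToContinuousLinearEquiv_coe] at h

/-- **Translated form** (the shape in which the ω-limit machinery consumes chart metrics: the
time-translates `y ↦ (Ψ^* g)(y + e)`, e.g. `e = Tₙ • Λe₀`): for a vacuum development and a smooth chart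
map `Ψ`, `ricAt (fun y ↦ chartMetricExtend B Ψ (y + e)) x = 0` whenever `x + e` is a point of the
domain at which `dΨ` is injective — every ingredient of `ricAt` is built from `fderiv`, which commutes
with translations (`MetricCoord.ricAt_comp_add_right`). [cite: ONeill1983, Ch. 3, Lemma 3.52] -/
theorem ricAt_chartMetricExtend_translate_eq_zero {X : Type} [TopologicalSpace X]
    [ChartedSpace E3 X] [IsManifold (𝓡 3) ∞ X] [ConnectedSpace X] {D : InitialDataSet (𝓡 3) X}
    (𝒟 : VacuumCauchyDevelopment D) (B : ModelBackground) {Ψ : B.domain → 𝒟.carrier}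
    (hΨ : ContMDiff 𝓘(ℝ, E4) (𝓡 4) ∞ Ψ) (e : E4) {x : E4} (hx : x + e ∈ (B.domain : Set E4))
    (hinj : Function.Injective (mfderiv 𝓘(ℝ, E4) (𝓡 4) Ψ ⟨x + e, hx⟩)) :
    MetricCoord.ricAt (fun y ↦ 𝒟.toSpacetime.chartMetricExtend B Ψ (y + e)) x = 0 := by
  rw [MetricCoord.ricAt_comp_add_right]
  ext Y Z
  exact ricAt_chartMetricExtend_eq_zero 𝒟 B Ψ hΨ ⟨x + e, hx⟩ hinj Y Z

end Summit.FinalStateConjecture.FinalStateConjecture.Theorems.ClusterCompleteness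

end
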